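import Literature.AnabelianGeometry.SemiGraphs.ZariskiMainTheorem

/-!
# [SemiAnbd] Lemma 1.3 (i) — proof companion to `ZariskiMainTheorem.lean`

Mochizuki, *Semi-graphs of anabelioids*, Publ. RIMS **42** (2006) 221–322, §1, author's manuscript
p. 17 [cite: MochizukiSemiAnbd2006, Lem. 1.3 p.17].  This file DISCHARGES the named fact
`SemiGraph.lemma_1_3_i` of `ZariskiMainTheorem.lean` (statement by abc-iut-L3-t1), following the
printed proof ("Given a morphism `φ : G → H_n`, we obtain orientations and colors on the edges of `G`
by pulling back the orientations and colors of `H_n` via `φ`.  Conversely, given a choice of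
orientations and colors on the edges of `G`, we obtain a morphism `φ : G → H_n` …"): the assignment
`toBouquet` (orientation, colouring) ↦ (`G → H_n`) is bijective — its inverse pulls back the direction
bits (`Equiv.ofBijective` on the two branches of each edge) and the colours (`edgeMap`); the finiteness
hypotheses of the statement are not needed.  (Lemma 1.3 (iii) is discharged in `BouquetCriteria.lean`,
abc-iut-L3-t1.)  No new statements; proof-only companion (abc-iut cell, layer L3, DISCHARGE-C item
C2).
-/

namespace Literature.AnabelianGeometry.SemiGraphs

namespace SemiGraph

open CategoryTheory

universe u

/-! ### Lemma 1.3 (i): morphisms `G → H_n` are orientations plus colourings -/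

section LemmaI

variable {G : SemiGraph.{u}} {n : ℕ}

/-- For `φ : G → H_n`, the colour component of the image of a branch is the colour of its edge.
[cite: MochizukiSemiAnbd2006, Lem. 1.3(i) p.17] -/
theorem branchMap_down_fst (φ : G ⟶ bouquet.{u} n) (b : G.Branch) :
    (φ.branchMap b).down.1 = (φ.edgeMap (G.edgeOf b)).down :=
  congrArg ULift.down (φ.edgeOf_branchMap b)

/-- For `φ : G → H_n`, two branches of the same edge with the same direction bit have the same image,
hence coincide. [cite: MochizukiSemiAnbd2006, Lem. 1.3(i) p.17] -/
theorem branch_eq_of_dir_eq (φ : G ⟶ bouquet.{u} n) {b₁ b₂ : G.Branch}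
    (he : G.edgeOf b₁ = G.edgeOf b₂) (hd : (φ.branchMap b₁).down.2 = (φ.branchMap b₂).down.2) :
    b₁ = b₂ := by
  refine φ.branchMap_injOn b₁ b₂ he (congrArg ULift.up (Prod.ext ?_ hd))
  rw [branchMap_down_fst, branchMap_down_fst, he]

/-- The direction map of an edge "pulled back via `φ`" from `H_n` is a bijection of its two branches
with `Bool` (proof of Lemma 1.3 (i), p. 17). [cite: MochizukiSemiAnbd2006, Lem. 1.3(i) p.17] -/
theorem dir_bijective (φ : G ⟶ bouquet.{u} n) (e : G.Edge) :
    Function.Bijective (fun x : {b : G.Branch // G.edgeOf b = e} => (φ.branchMap x.1).down.2) := by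
  have hinj : Function.Injective
      (fun x : {b : G.Branch // G.edgeOf b = e} => (φ.branchMap x.1).down.2) := by
    intro x y hxy
    exact Subtype.ext (branch_eq_of_dir_eq φ (x.2.trans y.2.symm) hxy)
  refine ⟨hinj, fun d => ?_⟩
  obtain ⟨b₁, b₂, hne, h₁, h₂, -⟩ := G.two_branches e
  by_contra hd
  have hd₁ : (φ.branchMap b₁).down.2 ≠ d := fun h => hd ⟨⟨b₁, h₁⟩, h⟩
  have hd₂ : (φ.branchMap b₂).down.2 ≠ d := fun h => hd ⟨⟨b₂, h₂⟩, h⟩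
  have heq : (φ.branchMap b₁).down.2 = (φ.branchMap b₂).down.2 := by
    cases d <;> cases h : (φ.branchMap b₁).down.2 <;> cases h' : (φ.branchMap b₂).down.2 <;>
      simp_all
  exact hne (congrArg Subtype.val (hinj (a₁ := ⟨b₁, h₁⟩) (a₂ := ⟨b₂, h₂⟩) heq))

/-- The morphism determined by the orientation and colouring "pulled back via `φ`" from `H_n` (the
direction bits `Equiv.ofBijective _ (dir_bijective φ e)` and the colours `φ.edgeMap`) is `φ` itself
(proof of Lemma 1.3 (i), p. 17: surjectivity of the assignment).
[cite: MochizukiSemiAnbd2006, Lem. 1.3(i) p.17] -/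
theorem toBouquet_pullback_eq (φ : G ⟶ bouquet.{u} n) :
    toBouquet (fun e => Equiv.ofBijective _ (dir_bijective φ e)) (fun e => φ.edgeMap e) = φ := by
  refine SemiGraph.hom_ext _ _ (funext fun _ => rfl) (funext fun _ => rfl) (funext fun b => ?_)
  change (⟨((φ.edgeMap (G.edgeOf b)).down,
      Equiv.ofBijective _ (dir_bijective φ (G.edgeOf b)) ⟨b, rfl⟩)⟩ : ULift (Fin n × Bool)) =
    φ.branchMap b
  refine congrArg ULift.up (Prod.ext ?_ rfl)
  exact (branchMap_down_fst φ b).symm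

/-- Conversely, the orientation and colouring are recovered from `toBouquet o c` (proof of Lemma 1.3
(i), p. 17): injectivity of the assignment. [cite: MochizukiSemiAnbd2006, Lem. 1.3(i) p.17] -/
theorem toBouquet_injective :
    Function.Injective (fun p : G.Orientation × G.Coloring n => toBouquet p.1 p.2) := by
  rintro ⟨o, c⟩ ⟨o', c'⟩ h
  have hc : c = c' := funext fun e => congrArg (fun ψ : G ⟶ bouquet n => ψ.edgeMap e) h
  have hb : ∀ b : G.Branch, o (G.edgeOf b) ⟨b, rfl⟩ = o' (G.edgeOf b) ⟨b, rfl⟩ := fun b => by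
    have := congrArg (fun ψ : G ⟶ bouquet n => (ψ.branchMap b).down.2) h
    exact this
  have ho : o = o' := by
    funext e
    refine Equiv.ext fun x => ?_
    obtain ⟨b, rfl⟩ := x
    exact hb b
  simp only [ho, hc]

/-- DISCHARGE of `lemma_1_3_i` ([SemiAnbd] Lemma 1.3 (i)): "to give a morphism `φ : G → H_n` is
equivalent to assigning an orientation and a “color” `∈ {1, …, n}` to each edge of `G`".
[cite: MochizukiSemiAnbd2006, Lem. 1.3(i) p.17] -/
theorem lemma_1_3_i_holds : lemma_1_3_i.{u} := by
  intro G n _ _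
  exact ⟨toBouquet_injective, fun φ =>
    ⟨(fun e => Equiv.ofBijective _ (dir_bijective φ e), fun e => φ.edgeMap e),
      toBouquet_pullback_eq φ⟩⟩

end LemmaI

end SemiGraph

end Literature.AnabelianGeometry.SemiGraphs
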